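import Summits.QuantumAdvantage.QuantumAdvantage.Theorems.RankDialK2
import HarnessLib

/-!
# RankDial (L3) — §31 MULTI-LIVENESS: the 2/3 law for class labels with cluster coordinates (`multiLiveness`), the kernel mechanism of node «BlockDial»

TARGET BY NAME (cell decomp-qadv, RESIDUAL MODE): item stmt-QuantumAdvantage-23109
`Summit.QuantumAdvantage.QuantumAdvantage.Theses.OddPrimeWalk.ManyReadersSqrtOdd`, through rung R5 = `AdviceFreeQNC0.WalkHardFLinSel p`.
This file SUPPORTS the item (`--supports`); it does not close it.  Declaration bodies are byte-identical to the cell node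
«BlockDial» (decomp-qadv lens-1, generation 27, part L; node file RankDialL.lean), cut into ≤ 400-line parts
L1 (§28 `WindowClassBias`; §29 `SepBlock`, `BlockPiece`, `ClusteredPiece`, `WindowPiece`, `R5 ⟺ BlockPiece ∧ ClusteredPiece`, `η = 1` recovery;
imports tree RankDialK2 + RankDialJ1) → L2 (§30 `BlockJSpan`, `BlockJSpread`, `blockPiece_of_jspan_jspread`, `r5_residual_block`, `block_dial`,
`closes_block`, `target_iff_block`; imports L1) and L3 (§31 multi-liveness: `card_filter_le_two_thirds`, `deadCount`, `WinLabel`, `multiLiveness`;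
pure counting, imports tree RankDialK2 only — independent of L1/L2).  See the node file for the mechanism summary and the tags.
-/

set_option linter.dupNamespace false
set_option autoImplicit false

noncomputable section
open Classical

namespace Summit.QuantumAdvantage.QuantumAdvantage.Theorems.RankDial

open Finset
open Summit.QuantumAdvantage.AdviceFreeQNC0
open Literature.Computability.MetaComplexity Literature.Computability.MetaComplexity.Smolensky

/-! ### §31 (part L «BlockDial») MULTI-LIVENESS — the 2/3 law for class labels with cluster coordinates -/

section MultiLiveness

/-- **The 3-shift lemma.**  If `σ` is a permutation of a finite type and no point `z` has all of `z, σ z, σ (σ z)` bad, then at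
most two thirds of the points are bad: `3·#bad = Σ_z (𝟙 z + 𝟙 (σ z) + 𝟙 (σ² z)) ≤ 2·|Z|`. -/
theorem card_filter_le_two_thirds {Z : Type*} [Fintype Z] (σ : Z ≃ Z) (bad : Z → Prop)
    (h : ∀ z, ¬ (bad z ∧ bad (σ z) ∧ bad (σ (σ z)))) :
    3 * (univ.filter fun z => bad z).card ≤ 2 * Fintype.card Z := by
  set f : Z → ℕ := fun z => if bad z then 1 else 0 with hf
  have h1 : (univ.filter fun z => bad z).card = ∑ z, f z := by
    rw [Finset.card_filter]
  have h2 : ∑ z, f (σ z) = ∑ z, f z := Equiv.sum_comp σ f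
  have h3 : ∑ z, f (σ (σ z)) = ∑ z, f z := by
    show ∑ z, (fun w => f (σ w)) (σ z) = _
    rw [Equiv.sum_comp σ (fun w => f (σ w))]
    exact h2
  have h4 : ∀ z, f z + f (σ z) + f (σ (σ z)) ≤ 2 := by
    intro z
    have hz := h z
    by_cases ha : bad z <;> by_cases hb : bad (σ z) <;> by_cases hc : bad (σ (σ z)) <;> simp [hf, ha, hb, hc] at hz ⊢
  calc 3 * (univ.filter fun z => bad z).card = ∑ z, f z + ∑ z, f (σ z) + ∑ z, f (σ (σ z)) := by
        rw [h1, h2, h3]; ring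
    _ = ∑ z, (f z + f (σ z) + f (σ (σ z))) := by rw [Finset.sum_add_distrib, Finset.sum_add_distrib]
    _ ≤ ∑ _z : Z, 2 := Finset.sum_le_sum fun z _ => h4 z
    _ = 2 * Fintype.card Z := by rw [Finset.sum_const, Finset.card_univ, smul_eq_mul, mul_comm]

/-- Every residue mod `3` is one of `x, x+1, x+2`. -/
theorem zmod3_cover (x y : ZMod 3) : y = x ∨ y = x + 1 ∨ y = x + 2 := by
  revert x y
  decide

/-- `Σ_{x : ℤ₃} f x = f 0 + f 1 + f 2`. -/
theorem sum_zmod3 (f : ZMod 3 → ℕ) : ∑ x, f x = f 0 + f 1 + f 2 := by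
  have hu : (univ : Finset (ZMod 3)) = {0, 1, 2} := by decide
  rw [hu, Finset.sum_insert (by decide), Finset.sum_insert (by decide), Finset.sum_singleton]
  ring

/-- `Σ_{x : ℤ₃} f x = f a + f (a+1) + f (a+2)` for every base point `a`. -/
theorem sum_zmod3_shift (f : ZMod 3 → ℕ) (a : ZMod 3) : ∑ x, f x = f a + f (a + 1) + f (a + 2) := by
  rw [← Equiv.sum_comp (Equiv.addLeft a) f, sum_zmod3]
  simp only [Equiv.coe_addLeft, add_zero]

variable {G : Type*} [Fintype G] {J : ℕ}

/-- The label coordinate a cut reads besides the class `z₀`: nothing for an OUTSIDE cut (`none`), the cluster prefix weight `w_j`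
for a cut of the `j`-th inside cluster (`some j`). -/
def coordOf (z : ZMod 3 × (Fin J → ZMod 3)) : Option (Fin J) → ZMod 3
  | none => 0
  | some j => z.2 j

/-- **Dead count.**  THE DICTIONARY (walk coordinates of `AdviceFreeQNC0.ringWinU`: a passing cut `g` is LIVE at `u` iff
`(c + g + wt u + wtPrefix u g) % 3 ≠ 0`).  Fix a block, the bits outside it (weights `α` before, `β` after), and inside the block the
positions `h₁ < … < h_J` carrying inside cuts (a cluster of nearby cuts is referred to its first position after conditioning on the
bits between its cuts).  For block content `v` put `z₀ := |v| mod 3` and `w_j := |v_{<h_j}| mod 3`.  Then `wt u ≡ α + z₀ + β` and: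
a cut LEFT of the block has `wtPrefix` constant, so it is dead iff `z₀ = k_g`; a cut RIGHT of it has `wtPrefix ≡ α + z₀ + const`,
dead iff `2 z₀ = const` iff `z₀ = k_g`; a cut AT `h_j` has `wtPrefix ≡ α + w_j`, dead iff `z₀ + w_j = k_g`.  So with `kind g = none`
for outside cuts and `kind g = some j` for cuts at `h_j`, the number of cuts of `G` dead at the label `z = (z₀, w)` is
`deadCount kind k z`. -/
def deadCount (kind : G → Option (Fin J)) (k : G → ZMod 3) (z : ZMod 3 × (Fin J → ZMod 3)) : ℕ :=
  (univ.filter fun g => z.1 + coordOf z (kind g) = k g).card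

/-- **Winning label.**  Take for `G` the set of PASSING cuts on a sub-fibre where the pass/fail pattern is fixed (the tests are
affine, so this is an affine sub-fibre — exactly how parts C–K use liveness).  The input WINS iff the number of passing cuts live at
its label is odd, i.e. iff `deadCount ≡ |G| + 1 (mod 2)`: the label is `WinLabel`. -/
def WinLabel (kind : G → Option (Fin J)) (k : G → ZMod 3) (z : ZMod 3 × (Fin J → ZMod 3)) : Prop :=
  deadCount kind k z % 2 = (Fintype.card G + 1) % 2

/-- Fibre counts: the number of cuts of a given kind with a given dead-value. -/
def kindCount (kind : G → Option (Fin J)) (k : G → ZMod 3) (o : Option (Fin J)) (x : ZMod 3) : ℕ :=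
  (univ.filter fun g => kind g = o ∧ k g = x).card

/-- `deadCount z = N_out(z₀) + Σ_j N_j(z₀ + w_j)`. -/
theorem deadCount_eq (kind : G → Option (Fin J)) (k : G → ZMod 3) (z : ZMod 3 × (Fin J → ZMod 3)) :
    deadCount kind k z = kindCount kind k none z.1 + ∑ j, kindCount kind k (some j) (z.1 + z.2 j) := by
  unfold deadCount
  rw [Finset.card_eq_sum_card_fiberwise (f := kind) (t := univ) (fun g _ => Finset.mem_univ _), Fintype.sum_option]
  congr 1
  · unfold kindCount
    rw [Finset.filter_filter]
    congr 1
    refine Finset.filter_congr fun g _ => ⟨?_, ?_⟩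
    · rintro ⟨h1, h2⟩
      refine ⟨h2, ?_⟩
      rw [h2] at h1
      simpa [coordOf] using h1.symm
    · rintro ⟨h2, h1⟩
      refine ⟨?_, h2⟩
      rw [h2]
      simpa [coordOf] using h1.symm
  · refine Finset.sum_congr rfl fun j _ => ?_
    unfold kindCount
    rw [Finset.filter_filter]
    congr 1
    refine Finset.filter_congr fun g _ => ⟨?_, ?_⟩
    · rintro ⟨h1, h2⟩
      refine ⟨h2, ?_⟩
      rw [h2] at h1
      exact h1.symm
    · rintro ⟨h2, h1⟩
      refine ⟨?_, h2⟩
      rw [h2]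
      exact h1.symm

/-- `|G| = Σ_x N_out(x) + Σ_j Σ_x N_j(x)`. -/
theorem card_eq_kindCount (kind : G → Option (Fin J)) (k : G → ZMod 3) :
    Fintype.card G = ∑ x, kindCount kind k none x + ∑ j, ∑ x, kindCount kind k (some j) x := by
  have hfib : ∀ o : Option (Fin J), (univ.filter fun g => kind g = o).card = ∑ x, kindCount kind k o x := by
    intro o
    rw [Finset.card_eq_sum_card_fiberwise (f := k) (t := univ) (fun g _ => Finset.mem_univ _)]
    refine Finset.sum_congr rfl fun x _ => ?_
    unfold kindCount
    rw [Finset.filter_filter]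
  rw [← Finset.card_univ, Finset.card_eq_sum_card_fiberwise (f := kind) (t := univ) (fun g _ => Finset.mem_univ _),
    Fintype.sum_option, hfib]
  exact congrArg _ (Finset.sum_congr rfl fun j _ => hfib (some j))

/-- **MULTI-LIVENESS** (the counting half of every block law; `J = 0` is the tree's two-liveness `not_three_odd` /
`sum_three_classes_le`).  For ANY finite family of cuts, each dead on an affine hyperplane `z₀ = k_g` (outside cuts) or
`z₀ + w_j = k_g` (cuts of inside cluster `j`), at most two thirds of the `3^{J+1}` labels are winning.  Proof: if for some cluster
`j` the parity of `N_j(x)` is not constant in `x`, shift `w_j` (the dead count changes only through `N_j(z₀ + w_j)`, and three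
consecutive winning labels would make that parity constant); otherwise shift `z₀` (then `deadCount ≡ N_out(z₀) + Σ_j N_j(0)`, and
three consecutive winning labels contradict `|G| ≡ Σ_x N_out(x) + Σ_j N_j(0)`).  With the 3-shift lemma either shift gives `2/3`. -/
theorem multiLiveness (kind : G → Option (Fin J)) (k : G → ZMod 3) :
    3 * (univ.filter fun z : ZMod 3 × (Fin J → ZMod 3) => WinLabel kind k z).card ≤
      2 * Fintype.card (ZMod 3 × (Fin J → ZMod 3)) := by
  set N := kindCount kind k with hN
  by_cases hA : ∃ j : Fin J, ∃ x x' : ZMod 3, N (some j) x % 2 ≠ N (some j) x' % 2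
  · -- Case A: shift the cluster coordinate `w_j`.
    obtain ⟨j, x₀, x₁, hne⟩ := hA
    set e : ZMod 3 × (Fin J → ZMod 3) := (0, Pi.single j 1) with he
    set σ := Equiv.addRight e with hσ
    have hfst : ∀ z : ZMod 3 × (Fin J → ZMod 3), (σ z).1 = z.1 := by
      intro z; simp [hσ, he]
    have hsame : ∀ z : ZMod 3 × (Fin J → ZMod 3), (σ z).2 j = z.2 j + 1 := by
      intro z; simp [hσ, he]
    have hne' : ∀ z : ZMod 3 × (Fin J → ZMod 3), ∀ i, i ≠ j → (σ z).2 i = z.2 i := by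
      intro z i hi; simp [hσ, he, Pi.single_eq_of_ne hi]
    -- the part of the dead count not involving cluster `j`
    set rest : ZMod 3 × (Fin J → ZMod 3) → ℕ :=
      fun z => N none z.1 + ∑ i ∈ univ.erase j, N (some i) (z.1 + z.2 i) with hrest
    have hsplit : ∀ z : ZMod 3 × (Fin J → ZMod 3), deadCount kind k z = rest z + N (some j) (z.1 + z.2 j) := by
      intro z
      rw [deadCount_eq, hrest, add_assoc, Finset.sum_erase_add _ _ (Finset.mem_univ j)]
    have hrestσ : ∀ z : ZMod 3 × (Fin J → ZMod 3), rest (σ z) = rest z := by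
      intro z
      simp only [hrest, hfst]
      congr 1
      exact Finset.sum_congr rfl fun i hi => by rw [hne' z i (Finset.ne_of_mem_erase hi)]
    apply card_filter_le_two_thirds σ
    rintro z ⟨h0, h1, h2⟩
    unfold WinLabel at h0 h1 h2
    rw [hsplit] at h0 h1 h2
    rw [hrestσ, hfst, hsame] at h1
    rw [hrestσ, hrestσ, hfst, hfst, hsame, hsame] at h2
    set x := z.1 + z.2 j with hx
    have e1 : z.1 + (z.2 j + 1) = x + 1 := by rw [hx]; ring
    have e2 : z.1 + (z.2 j + 1 + 1) = x + 2 := by rw [hx]; ring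
    rw [e1] at h1
    rw [e2] at h2
    -- the three parities of `N_j` at `x, x+1, x+2` agree, hence `N_j` has constant parity
    have hc : ∀ y : ZMod 3, N (some j) y % 2 = N (some j) x % 2 := by
      intro y
      rcases zmod3_cover x y with h | h | h <;> rw [h] <;> omega
    exact hne (by rw [hc x₀, hc x₁])
  · -- Case B: every cluster count has constant parity; shift the class coordinate `z₀`.
    push Not at hA
    set e : ZMod 3 × (Fin J → ZMod 3) := (1, 0) with he
    set σ := Equiv.addRight e with hσ
    have hfst : ∀ z : ZMod 3 × (Fin J → ZMod 3), (σ z).1 = z.1 + 1 := by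
      intro z; simp [hσ, he]
    set S0 := ∑ j, N (some j) 0 with hS0
    have hpar : ∀ y : Fin J → ZMod 3, (∑ j, N (some j) (y j)) % 2 = S0 % 2 := by
      intro y
      rw [hS0, Finset.sum_nat_mod, Finset.sum_congr rfl (fun j _ => hA j (y j) 0), ← Finset.sum_nat_mod]
    have hP : ∀ z : ZMod 3 × (Fin J → ZMod 3), deadCount kind k z % 2 = (N none z.1 + S0) % 2 := by
      intro z
      have h1 := deadCount_eq kind k z
      rw [← hN] at h1
      have h2 := hpar fun j => z.1 + z.2 j
      omega
    have hinner : ∀ j, (∑ x, N (some j) x) % 2 = N (some j) 0 % 2 := by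
      intro j
      rw [sum_zmod3]
      have h1 := hA j 1 0
      have h2 := hA j 2 0
      omega
    have hS : (∑ j, ∑ x, N (some j) x) % 2 = S0 % 2 := by
      rw [hS0, Finset.sum_nat_mod, Finset.sum_congr rfl (fun j _ => hinner j), ← Finset.sum_nat_mod]
    have hcard := card_eq_kindCount kind k
    rw [← hN] at hcard
    apply card_filter_le_two_thirds σ
    rintro z ⟨h0, h1, h2⟩
    unfold WinLabel at h0 h1 h2
    rw [hP] at h0 h1 h2
    rw [hfst] at h1
    rw [hfst, hfst] at h2
    have e2 : z.1 + 1 + 1 = z.1 + 2 := by ring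
    rw [e2] at h2
    have h3 := sum_zmod3_shift (N none) z.1
    omega

/-- `J = 0` (no inside cuts): the label is the class `z₀` alone and at most two of the three classes win — the tree's two-liveness
in the present vocabulary. -/
theorem twoLiveness_of_multi (kind : G → Option (Fin 0)) (k : G → ZMod 3) :
    3 * (univ.filter fun z : ZMod 3 × (Fin 0 → ZMod 3) => WinLabel kind k z).card ≤ 2 * 3 := by
  have h := multiLiveness kind k
  simpa [Fintype.card_prod, ZMod.card] using h

end MultiLiveness

end Summit.QuantumAdvantage.QuantumAdvantage.Theorems.RankDial
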